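import Summits.HodgeConjecture.CorCM.Model.Universe
import Summits.HodgeConjecture.CorCM.Geometry.Facts
import Literature.AlgebraicGeometry.HodgeTheory.BettiUniverseCMTypes
import Literature.AlgebraicGeometry.Milne1999.CMHodgeHypothesisFromCMTypedProducts
import HarnessLib

/-!
# COR-CM model rows M01–M04, M07, M13, M14 (+ asides pull_id, tr_degree, cmAV, cmEnd) for the model of
# record `Model.universeOf hHD hI hU h₃` — PORT of the stage-1 kernel proofs

Cell `pub-hodgecm2`, seat model-2 (BINDER-OWNERS.md v1 rows M01 pull_comp, M02 pull_cup, M03 pull_hodge,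
M04 pms_dim, M07 H1_rank, M13 eigenLine, M14 alphaLine). Every proof is the stage-1 package's
(`HodgeCM/Model/Universe.lean` `universeOf_modelAxiomsPerL`, `universeOf_finrank_H1`, `universeOf_cmAV_dim`;
`HodgeCM/Model/UniverseCM.lean` §CMFacts and `universeOf_fact_*`), read over the tree copies
`Summit.HodgeConjecture.CorCM.{Universe, Model.universeOf}` and the tree theorems
`BettiUniverse.{pull_comp, pull_cup, pull_hodge, cup2_hodge, pull_id, tr_of_ne, finrank_bettiCohomology_eq,
finrank_eigenLine_eq_one, eigenPiece_one_zero_eq_eigenLine, eigenPiece_one_zero_eq_bot, exists_pull_eq_cmEndAction}`.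
KERNEL over the records `hHD hI hU h₃`; nothing cited, NO definition (stage-1's transported
embedding `cmCodeEmb K Φ σ := σ ∘ e⁻¹` is kept inline as a term, so the file is theorems-only; filed by seat b24 as
model-2's successor, otherwise verbatim model-2's staged file md5 9b8cc9dc3e75).
-/

noncomputable section

open scoped TensorProduct
open NumberField CategoryTheory
open Literature.AlgebraicGeometry.Motives (CMType AbelianVariety bettiCohomology)
open Literature.AlgebraicGeometry.Motives
open Literature.AlgebraicGeometry.Motives.HodgeStructure (EndAction)

namespace Summit.HodgeConjecture.CorCM

namespace Model

open Literature.NumberTheory.Automorphic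
open Literature.NumberTheory.Automorphic.PicardCM
open Literature.AlgebraicGeometry.HodgeTheory
open Literature.AlgebraicGeometry.ComplexMultiplication (IsCMTypeRealisation)
open Literature.AlgebraicGeometry.Milne1999 (cmRealisation_isCMTypeRealisation)


/-! ### M01–M04 (the PerL cone, stage-1 `universeOf_modelAxiomsPerL`), M05 aside (pull_id), tr_degree -/

/-- **M01 `Fact_pull_comp`** for `universeOf` (`BettiUniverse.pull_comp`). [folklore] -/
theorem universeOf_fact_pull_comp (hHD : exists_isReal_hodgeModel) (hI : hodgePQ_independent_of_hodgeModel)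
    (hU : BallQuotientUniformisedDatum) (h₃ : CMAbelianVarietyRealised) : (universeOf hHD hI hU h₃).Fact_pull_comp :=
  fun _ _ _ f g k ↦ BettiUniverse.pull_comp f g k

/-- **M02 `Fact_pull_cup`** for `universeOf` (`BettiUniverse.pull_cup`). [folklore] -/
theorem universeOf_fact_pull_cup (hHD : exists_isReal_hodgeModel) (hI : hodgePQ_independent_of_hodgeModel)
    (hU : BallQuotientUniformisedDatum) (h₃ : CMAbelianVarietyRealised) : (universeOf hHD hI hU h₃).Fact_pull_cup :=
  fun _ _ f i j x y ↦ BettiUniverse.pull_cup f i j x y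

/-- **M03 `Fact_pull_hodge`** for `universeOf` (`BettiUniverse.pull_hodge`, over `hHD`, `hI`). [folklore] -/
theorem universeOf_fact_pull_hodge (hHD : exists_isReal_hodgeModel) (hI : hodgePQ_independent_of_hodgeModel)
    (hU : BallQuotientUniformisedDatum) (h₃ : CMAbelianVarietyRealised) : (universeOf hHD hI hU h₃).Fact_pull_hodge :=
  fun X Y f k p ↦ BettiUniverse.pull_hodge hHD hI (Var.isSmoothProjective hU h₃ X)
    (Var.isSmoothProjective hU h₃ Y) f k p

/-- **(PerL cone) `Fact_cup2_hodge`** for `universeOf` (`BettiUniverse.cup2_hodge`). [folklore] -/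
theorem universeOf_fact_cup2_hodge (hHD : exists_isReal_hodgeModel) (hI : hodgePQ_independent_of_hodgeModel)
    (hU : BallQuotientUniformisedDatum) (h₃ : CMAbelianVarietyRealised) : (universeOf hHD hI hU h₃).Fact_cup2_hodge :=
  fun X k p q x y hx hy ↦ BettiUniverse.cup2_hodge hHD hI (Var.isSmoothProjective hU h₃ X) k p q x y hx hy

/-- **M04 `PmsDimTwo`** for `universeOf` (by `rfl`: the code of a Picard modular surface has `dim = 2`). [folklore] -/
theorem universeOf_pmsDimTwo (hHD : exists_isReal_hodgeModel) (hI : hodgePQ_independent_of_hodgeModel)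
    (hU : BallQuotientUniformisedDatum) (h₃ : CMAbelianVarietyRealised)
    : (universeOf hHD hI hU h₃).PmsDimTwo := fun _ _ _ _ ↦ rfl

/-- **M05 `Fact_pull_id`** for `universeOf` (`BettiUniverse.pull_id`). [folklore] -/
theorem universeOf_fact_pull_id (hHD : exists_isReal_hodgeModel) (hI : hodgePQ_independent_of_hodgeModel)
    (hU : BallQuotientUniformisedDatum) (h₃ : CMAbelianVarietyRealised) : (universeOf hHD hI hU h₃).Fact_pull_id :=
  fun X k ↦ BettiUniverse.pull_id (Var.scheme hU h₃ X) k

/-- **`Fact_tr_degree`** for `universeOf` (`BettiUniverse.tr_of_ne`). [folklore] -/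
theorem universeOf_fact_tr_degree (hHD : exists_isReal_hodgeModel) (hI : hodgePQ_independent_of_hodgeModel)
    (hU : BallQuotientUniformisedDatum) (h₃ : CMAbelianVarietyRealised) : (universeOf hHD hI hU h₃).Fact_tr_degree :=
  fun X _ hk ↦ BettiUniverse.tr_of_ne (Var.isSmoothProjective hU h₃ X) hk

/-! ### M07 `H1_rank`, M-aside `cmAV` (stage-1 `universeOf_finrank_H1`, `universeOf_cmAV_dim`) -/

/-- **M07 `Fact_H1_rank`** for `universeOf`: `dim_ℚ H¹(A_{(K,Φ)}, ℚ) = [K:ℚ]`. [folklore] -/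
theorem universeOf_fact_H1_rank (hHD : exists_isReal_hodgeModel) (hI : hodgePQ_independent_of_hodgeModel)
    (hU : BallQuotientUniformisedDatum) (h₃ : CMAbelianVarietyRealised) : (universeOf hHD hI hU h₃).Fact_H1_rank := by
  intro K Φ
  change Module.finrank ℚ (bettiCohomology (cmRealisation h₃ (cmCode K Φ)).A 1) = _
  rw [BettiUniverse.finrank_bettiCohomology_eq (cmRealisation h₃ (cmCode K Φ)).isSmoothProjective 1,
    (cmRealisation h₃ (cmCode K Φ)).finrank_eq, cmCode, CMCode.finrank_ofCMType_E]

/-- **`Fact_cmAV`** for `universeOf`: `cmAV K Φ` is indexed as a CM abelian variety of dimension `[K:ℚ]/2`. [folklore] -/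
theorem universeOf_fact_cmAV (hHD : exists_isReal_hodgeModel) (hI : hodgePQ_independent_of_hodgeModel)
    (hU : BallQuotientUniformisedDatum) (h₃ : CMAbelianVarietyRealised) : (universeOf hHD hI hU h₃).Fact_cmAV := by
  intro K Φ
  refine ⟨Var.isAbelianVariety_cm h₃ _, Var.isCMAbelianVariety_cm h₃ _, ?_⟩
  change Module.finrank ℚ (cmCode K Φ).E / 2 = Module.finrank ℚ K / 2
  rw [cmCode, CMCode.finrank_ofCMType_E]

/-! ### The CM clauses of record (iii) transported along `cmCodeEquiv` (stage-1 `Model/UniverseCM.lean` §CMFacts) -/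

section CMFacts

variable (K : CMField) (Φ : CMType K) (σ : K →+* ℂ)

/-- `σ' ∘ e = σ` for the abstract embedding `σ : K →+* ℂ` read on the code field, `σ' := σ ∘ e⁻¹`
(stage-1's `cmCodeEmb K Φ σ`, kept INLINE here as the term `σ.comp (cmCodeEquiv K Φ).symm.toRingHom` so that this
file declares theorems only). [folklore] -/
@[simp] theorem cmCodeEmb_comp :
    (σ.comp (cmCodeEquiv K Φ).symm.toRingHom).comp (cmCodeEquiv K Φ).toRingHom = σ := by
  ext a; simp

/-- `σ' ∈ Φ_code ↔ σ ∈ Φ`. [folklore] -/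
theorem cmCodeEmb_mem_iff : σ.comp (cmCodeEquiv K Φ).symm.toRingHom ∈ (cmCode K Φ).Φ.1 ↔ σ ∈ Φ.1 := by
  change (σ.comp (cmCodeEquiv K Φ).symm.toRingHom).comp (cmCodeEquiv K Φ).toRingHom ∈ Φ.1 ↔ _
  rw [cmCodeEmb_comp]

/-- The joint `σ`-eigenspace of the transported action is the record's `σ'`-eigenline. [folklore] -/
theorem iInf_eigenspace_cmCode (h₃ : CMAbelianVarietyRealised) :
    (⨅ a : K, Module.End.eigenspace
        (((cmRealisation h₃ (cmCode K Φ)).θ.comp (cmCodeEquiv K Φ).toRingHom) a) (σ a)) =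
      eigenline (cmRealisation h₃ (cmCode K Φ)).θ (σ.comp (cmCodeEquiv K Φ).symm.toRingHom) := by
  have h := BettiUniverse.iInf_eigenspace_comp_ringEquiv (cmRealisation h₃ (cmCode K Φ)).θ
    (cmCodeEquiv K Φ) (σ.comp (cmCodeEquiv K Φ).symm.toRingHom)
  rw [cmCodeEmb_comp] at h
  exact h

/-- Clause `finrank_eigenline` of (iii), transported. [folklore] -/
theorem finrank_iInf_eigenspace_cmCode (h₃ : CMAbelianVarietyRealised) :
    Module.finrank ℂ ↥(⨅ a : K, Module.End.eigenspace
        (((cmRealisation h₃ (cmCode K Φ)).θ.comp (cmCodeEquiv K Φ).toRingHom) a) (σ a)) = 1 := by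
  rw [iInf_eigenspace_cmCode]
  exact (cmRealisation h₃ (cmCode K Φ)).finrank_eigenline _

/-- Clause `hodgeType_of_mem` of (iii), transported. [folklore] -/
theorem hodgeType_of_mem_cmCode (h₃ : CMAbelianVarietyRealised) (hσ : σ ∈ Φ.1) :
    ∀ v ∈ ⨅ a : K, Module.End.eigenspace
        (((cmRealisation h₃ (cmCode K Φ)).θ.comp (cmCodeEquiv K Φ).toRingHom) a) (σ a),
      IsOfHodgeType (Module.finrank ℚ (cmCode K Φ).E / 2) (cmRealisation h₃ (cmCode K Φ)).A 1 1 0 v := by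
  rw [iInf_eigenspace_cmCode]
  exact (cmRealisation h₃ (cmCode K Φ)).hodgeType_of_mem _ ((cmCodeEmb_mem_iff K Φ σ).2 hσ)

/-- Clause `hodgeType_of_not_mem` of (iii), transported. [folklore] -/
theorem hodgeType_of_not_mem_cmCode (h₃ : CMAbelianVarietyRealised) (hσ : σ ∉ Φ.1) :
    ∀ v ∈ ⨅ a : K, Module.End.eigenspace
        (((cmRealisation h₃ (cmCode K Φ)).θ.comp (cmCodeEquiv K Φ).toRingHom) a) (σ a),
      IsOfHodgeType (Module.finrank ℚ (cmCode K Φ).E / 2) (cmRealisation h₃ (cmCode K Φ)).A 1 0 1 v := by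
  rw [iInf_eigenspace_cmCode]
  exact (cmRealisation h₃ (cmCode K Φ)).hodgeType_of_not_mem _
    (fun h ↦ hσ ((cmCodeEmb_mem_iff K Φ σ).1 h))

end CMFacts

/-- **M13 `Fact_eigenLine`** for `universeOf` (`BettiUniverse.finrank_eigenLine_eq_one`). [folklore] -/
theorem universeOf_fact_eigenLine (hHD : exists_isReal_hodgeModel) (hI : hodgePQ_independent_of_hodgeModel)
    (hU : BallQuotientUniformisedDatum) (h₃ : CMAbelianVarietyRealised) : (universeOf hHD hI hU h₃).Fact_eigenLine :=
  fun K Φ σ ↦ BettiUniverse.finrank_eigenLine_eq_one _ _ hHD hI _ σ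
    (finrank_iInf_eigenspace_cmCode K Φ σ h₃)

/-- **M14 `Fact_alphaLine`** for `universeOf` — the CM-type condition for the chosen `A_{(K,Φ)}`. [folklore] -/
theorem universeOf_fact_alphaLine (hHD : exists_isReal_hodgeModel) (hI : hodgePQ_independent_of_hodgeModel)
    (hU : BallQuotientUniformisedDatum) (h₃ : CMAbelianVarietyRealised) : (universeOf hHD hI hU h₃).Fact_alphaLine :=
  fun K Φ σ ↦
    ⟨fun hσ ↦ BettiUniverse.eigenPiece_one_zero_eq_eigenLine _ _ hHD hI _ σ
        (hodgeType_of_mem_cmCode K Φ σ h₃ hσ),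
      fun hσ ↦ BettiUniverse.eigenPiece_one_zero_eq_bot _ _ hHD hI _ σ
        (hodgeType_of_not_mem_cmCode K Φ σ h₃ hσ)⟩

/-- **M12 `Fact_cmEnd`** for `universeOf` (`BettiUniverse.exists_pull_eq_cmEndAction`). [folklore] -/
theorem universeOf_fact_cmEnd (hHD : exists_isReal_hodgeModel) (hI : hodgePQ_independent_of_hodgeModel)
    (hU : BallQuotientUniformisedDatum) (h₃ : CMAbelianVarietyRealised) : (universeOf hHD hI hU h₃).Fact_cmEnd :=
  fun _ _ a ↦ BettiUniverse.exists_pull_eq_cmEndAction _ _ hHD hI _ a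

end Model

end Summit.HodgeConjecture.CorCM

end
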